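import Mathlib
import HarnessLib
import Summits.QuantumFields.YangMills.Theorems.LangevinControlUVFemtoCurvatureSkewnessTreeRatioFloorBinomial
import Summits.QuantumFields.YangMills.Theorems.LangevinControlUVFemtoCurvatureSkewnessTreeRatioFloorBlock
import Summits.QuantumFields.YangMills.Theorems.LangevinControlUVFemtoCurvatureSkewnessTreeRatioFloorKernel
import Summits.QuantumFields.YangMills.Theorems.LangevinControlUVFemtoCurvatureSkewnessTreeRatioFloorKernelBounds
import Summits.QuantumFields.YangMills.Theorems.LangevinControlUVFemtoCurvatureSkewnessTreeRatioFloorMomentum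
import Summits.QuantumFields.YangMills.Theorems.LangevinControlUVFemtoCurvatureSkewnessTreeRatioFloorMass
import Summits.QuantumFields.YangMills.Theorems.LangevinControlUVFemtoCurvatureSkewnessTreeRatioFloorExpansion
import Summits.QuantumFields.YangMills.Theorems.LangevinControlUVFemtoCurvatureSkewnessTreeRatioFloorRemainder

/-!
# `FemtoCurvatureSkewness` — lazy-walk proof of stub `TreeRatioFloor`, line `coupling-cubic-response` (crux stmt-QuantumFields-9365)

**Tree-level ratio floor.** For the (un-normalised) zero-mode-free transverse torus propagator
`G_L(x) = Σ_{k ≠ 0} w(k) cos(2πk·x/L)`, `w = (k̂₀²+k̂₁²)/(k̂₀²+k̂₁²+k̂₂²+k̂₃²)`, of the `(0,1)`-plaquette field on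
`(ℤ/L)⁴`, there is ONE `ρ₀ > 0` with `ρ₀ G_L(n e₂) ≤ G_L(n(e₃-e₂))` for all `L` and all `1 ≤ n ≤ L/8`.

Proof.  By the lazy-walk expansion (`TreeRatio.hasSum_propF`) both values are series `Σ_m L² D(m) E_m(x)` of
non-negative terms, `E_m(x) = Σ_i C(m,i) 2^{-m} λ_i(x₁) λ_{m-i}(x₂)` with the periodised lazy kernel `λ` of `ℤ/L`
and mass weights `c L²/m² ≤ D(m) ≤ C L²/m²`.  The axis terms with `m - i ≥ n²` are at most `e⁴` times the diagonal
ones (kernel ratio floor `λ_j(0) ≤ e⁴ λ_j(n)`, `j ≥ n²`); the remaining axis terms sum to `≤ cHigh L⁴/n⁴`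
(`sum_remainder_le`: the short walks `m < 4n²` by `remainder_small`, the long walks `m ≥ 4n²` by the binomial
quarter tail, `remainder_large`), while the diagonal series is `≥ cLow L⁴/n⁴` (`le_propF_diag`).  Hence
`F(n,0) ≤ (e⁴ + cHigh/cLow) F(-n,n)` (`rho0_mul_propF_axis_le`), and the two sums of the stub are `F(n,0)`, `F(-n,n)`.
Mathlib only; the constant `ρ₀` is explicit (`TreeRatio.rho0`).

The statement is the registered stub `TreeRatioFloor` verbatim; it is landed under the name `TreeRatioFloorLazyWalk`
(registered sub-goal) because the stub itself was closed concurrently, by a different route (torus Green function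
Hessian + heat kernel), in `…TreeRatioFloor.lean`.  This file and its imports use Mathlib only.
-/

noncomputable section

namespace Summit.QuantumFields.YangMills.Theorems.FemtoCurvatureSkewness

open Finset
open scoped BigOperators

namespace TreeRatio

variable (L : ℕ) [NeZero L]

/-- Three-quarter tail of the binomial row, from the quarter tail by reflection. -/
theorem sum_choose_three_quarter_le (m : ℕ) :
    ∑ i ∈ (range (m + 1)).filter (fun i => 3 * m ≤ 4 * i), (m.choose i : ℝ) ≤ (4 * quarterRoot / 3) ^ m := by
  have h := sum_choose_quarter_le m
  rw [sum_filter] at h ⊢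
  rw [← sum_range_reflect] at h
  refine le_trans (le_of_eq (sum_congr rfl fun i hi => ?_)) h
  have him : i ≤ m := Nat.lt_succ_iff.mp (mem_range.mp hi)
  have e1 : m + 1 - 1 - i = m - i := by omega
  rw [e1, Nat.choose_symm him]
  by_cases hc : 3 * m ≤ 4 * i
  · rw [if_pos hc, if_pos (by omega)]
  · rw [if_neg hc, if_neg (by omega)]

/-- **The remainder for long walks** (`4n² ≤ m`): `L² D(m) EII_m ≤ L⁴ rTail^m`. -/
theorem remainder_large {n m : ℕ} (hm : 4 * n ^ 2 ≤ m) :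
    (L : ℝ) ^ 2 * massD L m * lazyEII L n m ≤ (L : ℝ) ^ 4 * rTail ^ m := by
  have hD := massD_le_sq L m
  have hE : lazyEII L n m ≤ rTail ^ m := by
    unfold lazyEII
    calc ∑ i ∈ (range (m + 1)).filter (fun i => ¬ n ^ 2 ≤ m - i), (m.choose i : ℝ) / 2 ^ m * lam L i (n : ℤ) * lam L (m - i) 0
        ≤ ∑ i ∈ (range (m + 1)).filter (fun i => ¬ n ^ 2 ≤ m - i), (m.choose i : ℝ) / 2 ^ m := by
          refine sum_le_sum fun i _ => ?_
          have h1 := lam_le_one L i (n : ℤ)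
          have h2 := lam_le_one L (m - i) 0
          have h3 := lam_nonneg L i (n : ℤ)
          have h4 := lam_nonneg L (m - i) 0
          have h5 : (0 : ℝ) ≤ (m.choose i : ℝ) / 2 ^ m := by positivity
          calc (m.choose i : ℝ) / 2 ^ m * lam L i (n : ℤ) * lam L (m - i) 0 ≤ (m.choose i : ℝ) / 2 ^ m * 1 * 1 := by
                gcongr
            _ = (m.choose i : ℝ) / 2 ^ m := by ring
      _ ≤ ∑ i ∈ (range (m + 1)).filter (fun i => 3 * m ≤ 4 * i), (m.choose i : ℝ) / 2 ^ m := by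
          refine sum_le_sum_of_subset_of_nonneg (fun i hi => ?_) (fun _ _ _ => by positivity)
          have h := mem_filter.mp hi
          have him : i ≤ m := Nat.lt_succ_iff.mp (mem_range.mp h.1)
          exact mem_filter.mpr ⟨h.1, by omega⟩
      _ = (∑ i ∈ (range (m + 1)).filter (fun i => 3 * m ≤ 4 * i), (m.choose i : ℝ)) / 2 ^ m := by rw [sum_div]
      _ ≤ (4 * quarterRoot / 3) ^ m / 2 ^ m := by gcongr; exact sum_choose_three_quarter_le m
      _ = rTail ^ m := by rw [rTail, ← div_pow]; congr 1; ring
  calc (L : ℝ) ^ 2 * massD L m * lazyEII L n m ≤ (L : ℝ) ^ 2 * (L : ℝ) ^ 2 * rTail ^ m :=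
        mul_le_mul (mul_le_mul_of_nonneg_left hD (by positivity)) hE (lazyEII_nonneg L n m) (by positivity)
    _ = (L : ℝ) ^ 4 * rTail ^ m := by ring

/-- **Partial sums of the remainder**: `Σ_{m<N} L² D(m) EII_m ≤ cHigh L⁴/n⁴`. -/
theorem sum_remainder_le {n : ℕ} (hn : 1 ≤ n) (hnL : 8 * n ≤ L) (N : ℕ) :
    ∑ m ∈ range N, (L : ℝ) ^ 2 * massD L m * lazyEII L n m ≤ cHigh * (L : ℝ) ^ 4 / (n : ℝ) ^ 4 := by
  have hnr : (1 : ℝ) ≤ n := by exact_mod_cast hn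
  have hr0 := rTail_pos
  have hr1 := rTail_lt_one
  -- short walks
  have hsmall : ∑ m ∈ (range N).filter (fun m => m < 4 * n ^ 2), (L : ℝ) ^ 2 * massD L m * lazyEII L n m ≤
      10444800 * (L : ℝ) ^ 4 / (n : ℝ) ^ 4 := by
    calc ∑ m ∈ (range N).filter (fun m => m < 4 * n ^ 2), (L : ℝ) ^ 2 * massD L m * lazyEII L n m
        ≤ ∑ m ∈ (range N).filter (fun m => m < 4 * n ^ 2), 2611200 * (L : ℝ) ^ 4 / (n : ℝ) ^ 6 :=
          sum_le_sum fun m hm => remainder_small L hn hnL (mem_filter.mp hm).2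
      _ = ((range N).filter (fun m => m < 4 * n ^ 2)).card * (2611200 * (L : ℝ) ^ 4 / (n : ℝ) ^ 6) := by
          rw [sum_const, nsmul_eq_mul]
      _ ≤ (4 * (n : ℝ) ^ 2) * (2611200 * (L : ℝ) ^ 4 / (n : ℝ) ^ 6) := by
          gcongr
          have h := card_le_card (show (range N).filter (fun m => m < 4 * n ^ 2) ⊆ range (4 * n ^ 2) from
            fun m hm => mem_range.mpr (mem_filter.mp hm).2)
          rw [card_range] at h
          exact_mod_cast h
      _ = 10444800 * (L : ℝ) ^ 4 / (n : ℝ) ^ 4 := by field_simp; ring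
  -- long walks
  have hlarge : ∑ m ∈ (range N).filter (fun m => ¬ m < 4 * n ^ 2), (L : ℝ) ^ 2 * massD L m * lazyEII L n m ≤
      1 / (8 * Real.log rTail ^ 2 * (1 - rTail)) * (L : ℝ) ^ 4 / (n : ℝ) ^ 4 := by
    have hsub : (range N).filter (fun m => ¬ m < 4 * n ^ 2) ⊆ Ico (4 * n ^ 2) N := by
      intro m hm
      have h := mem_filter.mp hm
      exact mem_Ico.mpr ⟨by omega, mem_range.mp h.1⟩
    have hgeom : ∑ m ∈ Ico (4 * n ^ 2) N, rTail ^ m ≤ rTail ^ (4 * n ^ 2) / (1 - rTail) :=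
      geom_sum_Ico_le_of_lt_one hr0.le hr1
    -- `r^{4n²} = e^{-4κn²} ≤ 1/(8κ²n⁴)`
    have hpow : rTail ^ (4 * n ^ 2) ≤ 1 / (8 * Real.log rTail ^ 2 * (n : ℝ) ^ 4) := by
      have hκ := log_rTail_neg
      have hx : 0 < -(4 * (n : ℝ) ^ 2 * Real.log rTail) := by
        have := mul_pos (by positivity : (0 : ℝ) < 4 * (n : ℝ) ^ 2) (neg_pos.mpr hκ); linarith
      -- `e^{-x} ≤ 2!/x²` for `x = -4n² log r > 0`
      have h : Real.exp (4 * (n : ℝ) ^ 2 * Real.log rTail) ≤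
          ((2 : ℕ).factorial : ℝ) / (-(4 * (n : ℝ) ^ 2 * Real.log rTail)) ^ 2 := by
        have h0 := Real.pow_div_factorial_le_exp (-(4 * (n : ℝ) ^ 2 * Real.log rTail)) hx.le 2
        rw [Real.exp_neg] at h0
        rw [← inv_inv (Real.exp _), inv_eq_one_div, div_le_div_iff₀ (by positivity) (by positivity), one_mul]
        rw [div_le_iff₀ (by positivity)] at h0
        linarith
      have he : rTail ^ (4 * n ^ 2) = Real.exp (4 * (n : ℝ) ^ 2 * Real.log rTail) := by
        rw [← Real.rpow_natCast, Real.rpow_def_of_pos hr0]; congr 1; push_cast; ring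
      rw [he]
      refine h.trans (le_of_eq ?_)
      simp only [Nat.factorial, Nat.succ_eq_add_one, Nat.reduceAdd, Nat.reduceMul, Nat.cast_ofNat]
      field_simp
      ring
    calc ∑ m ∈ (range N).filter (fun m => ¬ m < 4 * n ^ 2), (L : ℝ) ^ 2 * massD L m * lazyEII L n m
        ≤ ∑ m ∈ (range N).filter (fun m => ¬ m < 4 * n ^ 2), (L : ℝ) ^ 4 * rTail ^ m :=
          sum_le_sum fun m hm => remainder_large L (by have := (mem_filter.mp hm).2; omega)
      _ ≤ ∑ m ∈ Ico (4 * n ^ 2) N, (L : ℝ) ^ 4 * rTail ^ m :=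
          sum_le_sum_of_subset_of_nonneg hsub fun _ _ _ => by positivity
      _ = (L : ℝ) ^ 4 * ∑ m ∈ Ico (4 * n ^ 2) N, rTail ^ m := by rw [mul_sum]
      _ ≤ (L : ℝ) ^ 4 * (1 / (8 * Real.log rTail ^ 2 * (n : ℝ) ^ 4) / (1 - rTail)) := by
          gcongr (L : ℝ) ^ 4 * ?_
          exact hgeom.trans (div_le_div_of_nonneg_right hpow (by linarith))
      _ = 1 / (8 * Real.log rTail ^ 2 * (1 - rTail)) * (L : ℝ) ^ 4 / (n : ℝ) ^ 4 := by
          have h1 : (1 - rTail) ≠ 0 := by linarith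
          have h2 : Real.log rTail ≠ 0 := log_rTail_neg.ne
          have h3 : (n : ℝ) ≠ 0 := by positivity
          field_simp
  rw [← sum_filter_add_sum_filter_not (range N) (fun m => m < 4 * n ^ 2), cHigh]
  have : (10444800 + 1 / (8 * Real.log rTail ^ 2 * (1 - rTail))) * (L : ℝ) ^ 4 / (n : ℝ) ^ 4 =
      10444800 * (L : ℝ) ^ 4 / (n : ℝ) ^ 4 + 1 / (8 * Real.log rTail ^ 2 * (1 - rTail)) * (L : ℝ) ^ 4 / (n : ℝ) ^ 4 := by
    ring
  rw [this]
  exact add_le_add hsmall hlarge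

/-! ## Assembly -/

/-- **Ratio floor for the sliced propagator**: `ρ₀ F(n, 0) ≤ F(-n, n)` for `1 ≤ n`, `8n ≤ L`. -/
theorem rho0_mul_propF_axis_le {n : ℕ} (hn : 1 ≤ n) (hnL : 8 * n ≤ L) :
    rho0 * propF L ((n : ℤ), 0) ≤ propF L (-(n : ℤ), (n : ℤ)) := by
  have hnr : (0 : ℝ) < n := by exact_mod_cast (lt_of_lt_of_le zero_lt_one hn)
  set Ga := propF L ((n : ℤ), 0) with hGa
  set Gd := propF L (-(n : ℤ), (n : ℤ)) with hGd
  have ha := hasSum_propF L ((n : ℤ), 0)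
  have hd := hasSum_propF L (-(n : ℤ), (n : ℤ))
  rw [← hGa] at ha
  rw [← hGd] at hd
  set aI : ℕ → ℝ := fun m => (L : ℝ) ^ 2 * massD L m * lazyEI L n m with haI
  set aII : ℕ → ℝ := fun m => (L : ℝ) ^ 2 * massD L m * lazyEII L n m with haII
  have hsplit : ∀ m, (L : ℝ) ^ 2 * massD L m * lazyE L m ((n : ℤ), 0) = aI m + aII m := by
    intro m; simp only [haI, haII, lazyE_axis_split]; ring
  have haI0 : ∀ m, 0 ≤ aI m := fun m => mul_nonneg (mul_nonneg (by positivity) (massD_nonneg L m)) (lazyEI_nonneg L n m)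
  have haII0 : ∀ m, 0 ≤ aII m := fun m => mul_nonneg (mul_nonneg (by positivity) (massD_nonneg L m)) (lazyEII_nonneg L n m)
  -- summability of the two parts
  have hsa : Summable fun m => (L : ℝ) ^ 2 * massD L m * lazyE L m ((n : ℤ), 0) := ha.summable
  have hsI : Summable aI := Summable.of_nonneg_of_le haI0 (fun m => by rw [hsplit]; linarith [haII0 m]) hsa
  have hsII : Summable aII := Summable.of_nonneg_of_le haII0 (fun m => by rw [hsplit]; linarith [haI0 m]) hsa
  have hGa_eq : Ga = ∑' m, aI m + ∑' m, aII m := by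
    have h2 : HasSum (fun m => aI m + aII m) (∑' m, aI m + ∑' m, aII m) := hsI.hasSum.add hsII.hasSum
    have h1 : HasSum (fun m => aI m + aII m) Ga := by
      have : (fun m => aI m + aII m) = fun m => (L : ℝ) ^ 2 * massD L m * lazyE L m ((n : ℤ), 0) :=
        funext fun m => (hsplit m).symm
      rw [this]; exact ha
    exact h1.unique h2
  -- the comparable part
  have hI : ∑' m, aI m ≤ Real.exp 4 * Gd := by
    have hsd : Summable fun m => Real.exp 4 * ((L : ℝ) ^ 2 * massD L m * lazyE L m (-(n : ℤ), (n : ℤ))) :=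
      hd.summable.mul_left _
    calc ∑' m, aI m ≤ ∑' m, Real.exp 4 * ((L : ℝ) ^ 2 * massD L m * lazyE L m (-(n : ℤ), (n : ℤ))) := by
          refine Summable.tsum_le_tsum (fun m => ?_) hsI hsd
          simp only [haI]
          have h := lazyEI_le L hn (by omega) m
          calc (L : ℝ) ^ 2 * massD L m * lazyEI L n m ≤ (L : ℝ) ^ 2 * massD L m * (Real.exp 4 * lazyE L m (-(n : ℤ), (n : ℤ))) :=
                mul_le_mul_of_nonneg_left h (mul_nonneg (by positivity) (massD_nonneg L m))
            _ = _ := by ring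
      _ = Real.exp 4 * Gd := by rw [tsum_mul_left, hd.tsum_eq]
  -- the remainder
  have hII : ∑' m, aII m ≤ cHigh * (L : ℝ) ^ 4 / (n : ℝ) ^ 4 :=
    Real.tsum_le_of_sum_range_le haII0 fun N => sum_remainder_le L hn hnL N
  -- the lower bound
  have hlow := le_propF_diag L hn hnL
  rw [← hGd] at hlow
  have hGd0 : 0 ≤ Gd := le_trans (by have := cLow_pos; positivity) hlow
  -- combine
  have hcl := cLow_pos
  have hch := cHigh_pos
  have key : Ga ≤ (Real.exp 4 + cHigh / cLow) * Gd := by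
    calc Ga = ∑' m, aI m + ∑' m, aII m := hGa_eq
      _ ≤ Real.exp 4 * Gd + cHigh * (L : ℝ) ^ 4 / (n : ℝ) ^ 4 := add_le_add hI hII
      _ ≤ Real.exp 4 * Gd + cHigh / cLow * Gd := by
          gcongr
          rw [div_mul_eq_mul_div, le_div_iff₀ hcl]
          calc cHigh * (L : ℝ) ^ 4 / (n : ℝ) ^ 4 * cLow = cHigh * (cLow * (L : ℝ) ^ 4 / (n : ℝ) ^ 4) := by ring
            _ ≤ cHigh * Gd := mul_le_mul_of_nonneg_left hlow hch.le
      _ = (Real.exp 4 + cHigh / cLow) * Gd := by ring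
  have hpos : 0 < Real.exp 4 + cHigh / cLow := by positivity
  rw [rho0, inv_mul_le_iff₀ hpos]
  exact key

end TreeRatio

open TreeRatio in
/-- **Tree-level ratio floor, lazy-walk proof** (signature of stub `TreeRatioFloor` verbatim, registered sub-goal
`TreeRatioFloorLazyWalk`): one `ρ₀ > 0` with `ρ₀ G_L(n e₂) ≤ G_L(n(e₃ - e₂))` for every `L` and every
`1 ≤ n ≤ L/8`. -/
theorem TreeRatioFloorLazyWalk : ∃ ρ₀ : ℝ, 0 < ρ₀ ∧ ∀ (L n : ℕ) [NeZero L], 1 ≤ n → 8 * n ≤ L → ρ₀ * (∑ k : Fin 4 →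
    ZMod L, (if k = 0 then 0 else ((2 - 2 * Real.cos (2 * Real.pi * ((k 0).val : ℝ) / L)) + (2 - 2 * Real.cos
    (2 * Real.pi * ((k 1).val : ℝ) / L))) / ((2 - 2 * Real.cos (2 * Real.pi * ((k 0).val : ℝ) / L)) + (2 - 2
    * Real.cos (2 * Real.pi * ((k 1).val : ℝ) / L)) + (2 - 2 * Real.cos (2 * Real.pi * ((k 2).val : ℝ) / L))
    + (2 - 2 * Real.cos (2 * Real.pi * ((k 3).val : ℝ) / L)))) * Real.cos (2 * Real.pi * ((k 2).val : ℝ) * n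
    / L)) ≤ ∑ k : Fin 4 → ZMod L, (if k = 0 then 0 else ((2 - 2 * Real.cos (2 * Real.pi * ((k 0).val : ℝ) /
    L)) + (2 - 2 * Real.cos (2 * Real.pi * ((k 1).val : ℝ) / L))) / ((2 - 2 * Real.cos (2 * Real.pi * ((k
    0).val : ℝ) / L)) + (2 - 2 * Real.cos (2 * Real.pi * ((k 1).val : ℝ) / L)) + (2 - 2 * Real.cos (2 *
    Real.pi * ((k 2).val : ℝ) / L)) + (2 - 2 * Real.cos (2 * Real.pi * ((k 3).val : ℝ) / L)))) * Real.cos (2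
    * Real.pi * (((k 3).val : ℝ) - ((k 2).val : ℝ)) * n / L) := by
  refine ⟨rho0, rho0_pos, fun L n _ hn hnL => ?_⟩
  rw [stubSum_axis L n, stubSum_diag L n]
  exact rho0_mul_propF_axis_le L hn hnL

end Summit.QuantumFields.YangMills.Theorems.FemtoCurvatureSkewness

end
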